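import Literature.Barriers.CriticalPhenomena.PlaquetteWalkHoleRootSevenAboveWest
import Literature.Barriers.CriticalPhenomena.PlaquetteWalkHoleRootSevenAboveClasses
import HarnessLib

/-!
# Barrier catalogue (SAWScalingLimit): the turn classes and the PHASE of the cost-`7` parents above the root row, end side `W` («COLUMN LAW», classes W)

`Z → ∞` limit model of the printed Yang–Baxter weights [GlazmanManolescu2019, §1, eq. (1)]; the «RECTANGLE COEFFICIENT» line of the venture lane «pcv-sawmu»
(b-engine-1 g27). The companion of `PlaquetteWalkHoleRootSevenAboveClasses` for the parents returning to the `W` side of `r`: from the frame data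
(`ΩG.frame_of_cost_seven_W_above`: prefix = root-row run, left turn `W → N` at `p₁`, straight climb into `r`, first arc in `r` = `S → E`; every kiss is `p₁`,
with arcs `W → N`, `E → S`) and the rigid excursion winding (`woundTurns S E W = −4`), ★ `ΩG.quarterTurnsL_of_cost_seven_W_above`: `q = −4`; the turn
bookkeeping then leaves ★★★ `ΩG.classes_of_cost_seven_W_above`: `(n_HL, n_VL, n_HR, n_VR; n_w₁, n_w₂) = (1,0,2,3; 0,0)` or `(2,0,2,4; 1,0)` (the census class
`(W,4,2,ε,0,−4)`), and ★★★ `ΩG.phaseIndex_ext₃_of_cost_seven_W_above`: the class-`B2b` member `ext₃ ω` (one more arc `W → N` in `r`, a second `θ`-corner there)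
has PHASE INDEX `3` (`ε = 0`) or `6` (`ε = 1`) — the `W`-half of the hypothesis `hphase` of `vertexFunctional_printed_zero_set_finite_above_of_phase`.
[GlazmanManolescu2019 §1 Fig. 1, eq. (1), Lemma 2.1 (eq. (CR)), Remark 2.2; Glazman2015WeightedSAW Lemma 3.1 (proof, pp. 6–7); Hopf1935 Nr. 2]
-/

noncomputable section

open private IsNS fc_fh from Literature.Probability.RandomPlanarGeometry.YangBaxterSAWGeneralDomain

namespace Literature.Probability.RandomPlanarGeometry.SAW.YangBaxter

open Real
open Literature.Barriers.CriticalPhenomena.PlaquetteWalk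

/-- Two different positions of a list satisfying a predicate give a count of at least two. [folklore] -/
private theorem two_le_countP_of_lt {α : Type*} (l : List α) (p : α → Bool) {i j : ℕ} (hij : i < j) (hj : j < l.length)
    (hi : p (l[i]'(lt_trans hij hj)) = true) (hjp : p (l[j]'hj) = true) : 2 ≤ l.countP p := by
  rw [← List.take_append_drop j l, List.countP_append]
  have h1 : 0 < (l.take j).countP p := by
    refine List.countP_pos_iff.2 ⟨(l.take j)[i]'(by simp; omega), List.getElem_mem _, ?_⟩
    rw [List.getElem_take]; exact hi
  have h2 : 0 < (l.drop j).countP p := by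
    refine List.countP_pos_iff.2 ⟨(l.drop j)[0]'(by simp; omega), List.getElem_mem _, ?_⟩
    rw [List.getElem_drop]; simpa using hjp
  omega

namespace ΩG

variable {D : Set Face} {w r : Face} {ω : ΩG D (w.side .W) r}

/-- ★ **THE COST-`7` PARENTS ABOVE THE ROW WITH END SIDE `W` WIND MINUS FOUR QUARTER TURNS**: `q(ω) = −4` — a left turn at `p₁`, a right turn at `r`
(`S → E`), and the four right turns of the wound excursion (`woundTurns S E W = −4`).
[cite: GlazmanManolescu2019, §2.1 (the winding); Lemma 2.1 (statement, «in the form given in [Gl]»)]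
[cite: Glazman2015WeightedSAW, Lemma 3.1 (proof, pp. 6–7)] [cite: Hopf1935, Nr. 2 (Umlaufsatz, p. 53)] -/
theorem quarterTurnsL_of_cost_seven_W_above (hh : holeFaceW w ∉ D) (hr : RootedFace D (w.side .W) r) (h : ω.IsB2a)
    (hA : ω.AJ hr h (toC (midPt (w.side .W))) ≠ 0) (hc : cost (slotOfSide ω.1) ω.2.mids = 7) (hW : ω.1 = .W)
    (hNS : arcKind (ω.2.sIn ω.2.firstHitG) (ω.2.sOut ω.2.firstHitG) ≠ .straight) (habove : w.2 < r.2) (hcol : w.1 ≤ r.1)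
    {k : ℕ} (hk : k < ω.2.arcs.length) (hstrk : ∀ i < k, arcKind (ω.2.sIn i) (ω.2.sOut i) = .straight)
    (hturnk : arcKind (ω.2.sIn k) (ω.2.sOut k) ≠ .straight) : quarterTurnsL ω.2.mids = -4 := by
  obtain ⟨hSin, hEout, hWk, hkN, hkF, hstr', -⟩ := frame_of_cost_seven_W_above hh hr h hA hc hW hNS habove hcol hk hstrk hturnk
  have hF := ω.fh_lt h
  obtain ⟨-, hf2, hf3⟩ := fc_fh' ω hr h
  have hexc := excursion_quarterTurns_of_wound hr h hA
  have hwt : woundTurns Side.S Side.E ω.1 = -4 := by rw [hW]; rfl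
  rw [← hf2, ← hf3, hSin, hEout, hwt] at hexc
  have hsum := ω.2.sum_qTurnOf_drop_of_one_turn hF hkF hstr' 0 (Nat.zero_le _)
  rw [List.drop_zero, if_pos (Nat.zero_le _), hWk, hkN, hSin, hEout, hexc] at hsum
  unfold quarterTurnsL
  change ((ω.2.arcs).map qTurnOf).sum = -4
  rw [hsum]; rfl

/-- ★★★ **THE TURN CLASSES OF THE COST-`7` PARENTS ABOVE THE ROOT ROW, END SIDE `W`**: `(n_HL, n_VL, n_HR, n_VR) = (1, 0, 2, 3)` with no doubly visited plaquette,
or `(2, 0, 2, 4)` with exactly one, a `w₁` plaquette (census classes `(W,4,2,ε,0,−4)`); in particular `n_VL = 0`, `n_w₂ = 0`, `n_w₁ ≤ 1`.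
[cite: GlazmanManolescu2019, §1, Fig. 1 and eq. (1); Lemma 2.1; Remark 2.2] [cite: Glazman2015WeightedSAW, Lemma 3.1 (proof, pp. 6–7)] -/
theorem classes_of_cost_seven_W_above (hh : holeFaceW w ∉ D) (hr : RootedFace D (w.side .W) r) (h : ω.IsB2a)
    (hA : ω.AJ hr h (toC (midPt (w.side .W))) ≠ 0) (hc : cost (slotOfSide ω.1) ω.2.mids = 7) (hW : ω.1 = .W)
    (hNS : arcKind (ω.2.sIn ω.2.firstHitG) (ω.2.sOut ω.2.firstHitG) ≠ .straight) (habove : w.2 < r.2) (hcol : w.1 ≤ r.1)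
    {k : ℕ} (hk : k < ω.2.arcs.length) (hstrk : ∀ i < k, arcKind (ω.2.sIn i) (ω.2.sOut i) = .straight)
    (hturnk : arcKind (ω.2.sIn k) (ω.2.sOut k) ≠ .straight) :
    vlCount ω.2.mids = 0 ∧ hrCount ω.2.mids = 2 ∧ cfgCount ω.2.mids [.coCorner, .coCorner] = 0 ∧
      ((hlCount ω.2.mids = 1 ∧ vrCount ω.2.mids = 3 ∧ cfgCount ω.2.mids [.corner, .corner] = 0) ∨
        (hlCount ω.2.mids = 2 ∧ vrCount ω.2.mids = 4 ∧ cfgCount ω.2.mids [.corner, .corner] = 1)) := by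
  classical
  obtain ⟨-, -, hWk, hkN, hkF, -, hkiss⟩ := frame_of_cost_seven_W_above hh hr h hA hc hW hNS habove hcol hk hstrk hturnk
  have hq4 := quarterTurnsL_of_cost_seven_W_above hh hr h hA hc hW hNS habove hcol hk hstrk hturnk
  set n := ω.2.arcs.length with hn
  have hq := quarterTurnsL_eq_classes ω.2.mids
  have htel := hvCount_sub_vhCount_walk ω.2
  obtain ⟨hhv, hvh⟩ := hvCount_eq ω.2
  have hz : vertB (r.side ω.1) = true := by rw [hW]; exact (vertB_side r).1
  rw [hhv, hvh, (vertB_side w).1, hz] at htel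
  have hc1 := countP_corner_eq ω.2.mids
  rw [countP_corner_eq_cfgCount ω.2] at hc1
  have hc2 := countP_coCorner_eq ω.2.mids
  rw [countP_coCorner_eq_cfgCount ω.2] at hc2
  have hd : slotDeg (slotOfSide ω.1) = 0 := by rw [hW]; rfl
  have h6 : cfgCount ω.2.mids [.corner] + cfgCount ω.2.mids [.coCorner] = 6 := by
    have hcost : cost (slotOfSide ω.1) ω.2.mids =
        cfgCount ω.2.mids [.corner] + cfgCount ω.2.mids [.coCorner] + (1 - slotDeg (slotOfSide ω.1)) := rfl
    rw [hcost, hd] at hc; omega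
  have hsingle : ∀ m < n, (∀ j < n, ω.2.fc j = ω.2.fc m → j = m) → ∀ κ : ArcKind, kindsL ω.2.mids (ω.2.fc m) ≠ [κ, κ] := by
    intro m hm hsv κ e
    rw [ω.2.kindsL_eq_singleton_of_single_visit hm hsv] at e
    exact absurd (congrArg List.length e) (by simp)
  have hw2 : cfgCount ω.2.mids [.coCorner, .coCorner] = 0 := by
    unfold cfgCount
    rw [List.countP_eq_zero]
    intro f hf hkf
    obtain ⟨m, hm, rfl⟩ := ω.2.exists_fc_eq_of_mem_facesL hf
    have hkf' : kindsL ω.2.mids (ω.2.fc m) = [.coCorner, .coCorner] := by simpa using hkf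
    by_cases hsv : ∀ j < n, ω.2.fc j = ω.2.fc m → j = m
    · exact hsingle m hm hsv _ hkf'
    · push Not at hsv
      obtain ⟨j, hj, hfj, hjm⟩ := hsv
      obtain ⟨-, hsides⟩ := hkiss m j hm hj hfj.symm (Ne.symm hjm)
      obtain ⟨l, hl, hfl, hkl⟩ := ω.2.exists_arc_of_mem_kindsL (show ArcKind.coCorner ∈ kindsL ω.2.mids (ω.2.fc m) by rw [hkf']; simp)
      rcases ω.2.eq_or_eq_of_fc_eq_three hm hj hl (Ne.symm hjm) hfj hfl with rfl | rfl
      · rcases hsides with ⟨h1, h2, -, -⟩ | ⟨h1, h2, -, -⟩ <;> rw [h1, h2] at hkl <;> exact absurd hkl (by decide)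
      · rcases hsides with ⟨-, -, h1, h2⟩ | ⟨-, -, h1, h2⟩ <;> rw [h1, h2] at hkl <;> exact absurd hkl (by decide)
  have hw1 : cfgCount ω.2.mids [.corner, .corner] ≤ 1 := by
    unfold cfgCount
    calc (facesL ω.2.mids).countP (fun f => kindsL ω.2.mids f = [.corner, .corner])
        ≤ (facesL ω.2.mids).countP (fun f => f = (w.1 + k, w.2)) := by
          refine List.countP_mono_left fun f hf hkf => ?_
          obtain ⟨m, hm, rfl⟩ := ω.2.exists_fc_eq_of_mem_facesL hf
          have hkf' : kindsL ω.2.mids (ω.2.fc m) = [.corner, .corner] := by simpa using hkf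
          by_cases hsv : ∀ j < n, ω.2.fc j = ω.2.fc m → j = m
          · exact absurd hkf' (hsingle m hm hsv _)
          · push Not at hsv
            obtain ⟨j, hj, hfj, hjm⟩ := hsv
            obtain ⟨hp, -⟩ := hkiss m j hm hj hfj.symm (Ne.symm hjm)
            simpa using hp
      _ = (facesL ω.2.mids).count ((w.1 + k, w.2) : Face) := by rw [List.count_eq_countP]; exact List.countP_congr fun f _ => by simp
      _ ≤ 1 := List.nodup_iff_count_le_one.1 (by unfold facesL; exact List.nodup_dedup _) _
  -- the first turn is a left turn entered horizontally; with a kiss, its second arc `E → S` is another one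
  have hHLk : (arcSides ω.2.arcs[k]).elim false isHL = true := by rw [ω.2.arcSides_getElem hk, hWk, hkN]; rfl
  have hhl1 : 1 ≤ hlCount ω.2.mids := by
    unfold hlCount classCount
    exact List.countP_pos_iff.2 ⟨ω.2.arcs[k], List.getElem_mem hk, hHLk⟩
  have hhl2 : cfgCount ω.2.mids [.corner, .corner] = 0 ∨ 2 ≤ hlCount ω.2.mids := by
    by_cases hinj : ∀ i j, i < n → j < n → ω.2.fc i = ω.2.fc j → i = j
    · exact Or.inl (ω.2.pairs_eq_zero_of_injective hinj).1
    · right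
      push Not at hinj
      obtain ⟨i, j, hi, hj, hfij, hij⟩ := hinj
      obtain ⟨-, hsides⟩ := hkiss i j hi hj hfij hij
      obtain ⟨l, hl, hEl, hSl⟩ : ∃ l < n, ω.2.sIn l = .E ∧ ω.2.sOut l = .S := by
        rcases hsides with ⟨-, -, h1, h2⟩ | ⟨h1, h2, -, -⟩
        · exact ⟨j, hj, h1, h2⟩
        · exact ⟨i, hi, h1, h2⟩
      have hHLl : (arcSides ω.2.arcs[l]).elim false isHL = true := by rw [ω.2.arcSides_getElem hl, hEl, hSl]; rfl
      have hkl : k ≠ l := by rintro rfl; rw [hWk] at hEl; exact absurd hEl (by decide)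
      unfold hlCount classCount
      rcases Nat.lt_or_gt_of_ne hkl with hlt | hgt
      · exact two_le_countP_of_lt _ _ hlt hl hHLk hHLl
      · exact two_le_countP_of_lt _ _ hgt hk hHLl hHLk
  refine ⟨by omega, by omega, hw2, ?_⟩
  rcases hhl2 with h0 | h2
  · left; refine ⟨?_, ?_, h0⟩ <;> omega
  · rcases Nat.lt_or_ge 0 (cfgCount ω.2.mids [.corner, .corner]) with hpos | hzero
    · right; refine ⟨?_, ?_, by omega⟩ <;> omega
    · left; refine ⟨?_, ?_, by omega⟩ <;> omega

/-- ★★★ **THE CLASS-`B2b` MEMBERS ABOVE THE ROOT ROW WITH A `W`-PARENT HAVE PHASE INDEX `3` OR `6`.** For a wound class-`B2a` walk of limit cost `7` at a rhombus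
`r` strictly above the root row with `w.1 ≤ r.1`, ending on the `W` side of `r` with a turning first arc, the extension `ext₃ ω` (which ends on `N`,
`ΩG.ext₃_fst_eq_N_of_above`) has `phaseIndex = 3` (no kiss) or `6` (the kiss at `p₁`). [cite: GlazmanManolescu2019, §1, Fig. 1 and eq. (1); Lemma 2.1, eq. (CR); Remark 2.2]
[cite: Glazman2015WeightedSAW, Lemma 3.1 (proof, pp. 6–7)] -/
theorem phaseIndex_ext₃_of_cost_seven_W_above (hh : holeFaceW w ∉ D) (hr : RootedFace D (w.side .W) r) (h : ω.IsB2a)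
    (hA : ω.AJ hr h (toC (midPt (w.side .W))) ≠ 0) (hc : cost (slotOfSide ω.1) ω.2.mids = 7) (hW : ω.1 = .W)
    (hNS : arcKind (ω.2.sIn ω.2.firstHitG) (ω.2.sOut ω.2.firstHitG) ≠ .straight) (habove : w.2 < r.2) (hcol : w.1 ≤ r.1) :
    phaseIndex (ω.ext₃ hr).2.mids = 3 ∨ phaseIndex (ω.ext₃ hr).2.mids = 6 := by
  have hk₁ex : ∃ k, arcKind (ω.2.sIn k) (ω.2.sOut k) ≠ .straight := ⟨_, hNS⟩
  have hkF : Nat.find hk₁ex ≤ ω.2.firstHitG := Nat.find_min' hk₁ex hNS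
  have hk : Nat.find hk₁ex < ω.2.arcs.length := lt_of_le_of_lt hkF (ω.fh_lt h)
  have hstrk : ∀ i < Nat.find hk₁ex, arcKind (ω.2.sIn i) (ω.2.sOut i) = .straight := by
    intro i hi; by_contra hne; exact Nat.find_min hk₁ex hi hne
  have hturnk : arcKind (ω.2.sIn (Nat.find hk₁ex)) (ω.2.sOut (Nat.find hk₁ex)) ≠ .straight := Nat.find_spec hk₁ex
  obtain ⟨hvl, -, hw2, hcases⟩ := classes_of_cost_seven_W_above hh hr h hA hc hW hNS habove hcol hk hstrk hturnk
  obtain ⟨hSin, hEout, -⟩ := frame_of_cost_seven_W_above hh hr h hA hc hW hNS habove hcol hk hstrk hturnk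
  obtain ⟨-, hsInF, hsOutF⟩ := fc_fh ω hr h
  have hN : IsNS ω hr := ⟨h, by rw [← hsInF, ← hsOutF]; exact hNS⟩
  obtain ⟨-, hf2, hf3⟩ := fc_fh' ω hr h
  obtain ⟨hz3, hvl', hcor, -⟩ := ext₃_phase_data hr hN
  have hkind : arcKind ω.2.firstSideG (ω.z1 hr h) = .corner := by rw [← hf2, ← hf3, hSin, hEout]; rfl
  obtain ⟨hco1, hco2⟩ := hcor hkind
  have hz3N : (ω.ext₃ hr).1 = .N := ext₃_fst_eq_N_of_above hh hr h hA hc (Or.inr hW) hNS habove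
  rw [hz3] at hz3N
  rw [hz3N] at hvl'
  have hVL : (if isVL (ω.1, Side.N) = true then 1 else 0) = 0 := by rw [hW]; rfl
  rw [hVL, add_zero] at hvl'
  unfold phaseIndex
  rw [hvl', hco1, hco2, hvl, hw2]
  rcases hcases with ⟨-, -, h0⟩ | ⟨-, -, h1⟩
  · left; rw [h0]
  · right; rw [h1]

end ΩG

end Literature.Probability.RandomPlanarGeometry.SAW.YangBaxter
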